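import Mathlib
import Summits.ValiantsHypothesis.ValiantsHypothesis.Theses.ChowBorderDepth3
import Summits.ValiantsHypothesis.ValiantsHypothesis.Theorems.ChowBorderDepth3ChowToThesis
import Summits.ValiantsHypothesis.ValiantsHypothesis.Theorems.ChowBorderDepth3BStableWitnessBoundRyserLocal
import Summits.ValiantsHypothesis.ValiantsHypothesis.Theorems.ChowBorderDepth3ChowBorderBoundStubTranslate
import Summits.ValiantsHypothesis.ValiantsHypothesis.Theorems.ChowBorderDepth3ChowBorderBoundStubInterpolate
import Summits.ValiantsHypothesis.ValiantsHypothesis.Theorems.ChowBorderDepth3ChowBorderBoundStubRescale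
import Summits.ValiantsHypothesis.ValiantsHypothesis.Theorems.ChowBorderDepth3ChowBorderBoundStubGradedOfLocal
import Summits.ValiantsHypothesis.ValiantsHypothesis.Theorems.ChowBorderDepth3ChowBorderBoundFanInTwoRung
import Summits.ValiantsHypothesis.ValiantsHypothesis.Theorems.ChowBorderDepth3ChowBorderBoundGoodPerm
import Summits.ValiantsHypothesis.ValiantsHypothesis.Theorems.ChowBorderDepth3ChowBorderBoundCoeffGraphSubst
import Summits.ValiantsHypothesis.ValiantsHypothesis.Theorems.ChowBorderDepth3ChowBorderBoundFanInBelowN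
import Summits.ValiantsHypothesis.ValiantsHypothesis.Theorems.ChowBorderDepth3ChowBorderBoundBorderFanInOne
import Summits.ValiantsHypothesis.ValiantsHypothesis.Theorems.ChowBorderDepth3ChowBorderBoundDefs
import Summits.ValiantsHypothesis.ValiantsHypothesis.Theorems.ChowBorderDepth3ChowBorderBoundFanInRungs
import Summits.ValiantsHypothesis.ValiantsHypothesis.Theorems.ChowBorderDepth3ChowBorderBoundQuotDerivCalc
import Summits.ValiantsHypothesis.ValiantsHypothesis.Theorems.ChowBorderDepth3ChowBorderBoundEpsSpan
import Summits.ValiantsHypothesis.ValiantsHypothesis.Theorems.ChowBorderDepth3ChowBorderBoundResidueTransfer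
import Summits.ValiantsHypothesis.ValiantsHypothesis.Theorems.ChowBorderDepth3ChowBorderBoundInitialFormTransfer
import Summits.ValiantsHypothesis.ValiantsHypothesis.Theorems.ChowBorderDepth3ChowBorderBoundDegenerationDatum
import Summits.ValiantsHypothesis.ValiantsHypothesis.Theorems.ChowBorderDepth3ChowBorderBoundMonomialLowerBound
import Summits.ValiantsHypothesis.ValiantsHypothesis.Theorems.ChowBorderDepth3ChowBorderBoundFanInTwoBounds
import Summits.ValiantsHypothesis.ValiantsHypothesis.Theorems.ChowBorderDepth3ChowBorderBoundFanInTwoChasmArith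
import Summits.ValiantsHypothesis.ValiantsHypothesis.Theorems.ChowBorderDepth3ChowBorderBoundFanInTwo

/-!
# Skeleton (lead's reshape of the birth skeleton BC3) for crux `ChowBorderDepth3.ChowBorderBound`
# (stmt-ValiantsHypothesis-5936), line `registered` = `vertex-normal-form`

Lead reshape (prover-line-stmt-ValiantsHypothesis-5936-0, 2026-08-17, cycle 1): the birth stub
L `stub_localisation` (size L) is split at the skeleton level into THREE registered stubs whose
composition is proved here (`stub_localisation_of`), so that independent workers can take them:

* **`stub_translate`** (TRUE; M).  Generic translation.  A border ΣΠΣ expression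
  `Σ_{i<r} Π_{j<D} ℓ_ij = ε^q per_n + ε^(q+1) G` (affine `ℓ_ij` over `ℂ[ε]`) becomes, after the
  `ℂ[ε]`-algebra map `x_v ↦ x_v + u_v` for a GENERIC `u ∈ ℂ[ε]^(n²)` (chosen with
  `MvPolynomial.funext` over the infinite domain `ℂ[ε]` so that every non-zero `ℓ_ij` gets the
  non-zero constant term `ℓ_ij(u)`), a weighted sum `Σ_i a_i Π_j (c_ij + L_ij(x))` with ALL
  `c_ij ≠ 0` (`a_i = 0`, `c_ij = 1` for the products that had a zero factor), equal to the
  TRANSLATE of the border target.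
* **`stub_interpolate`** (TRUE; M/L).  Degree-`n` extraction.  From the translated identity,
  Lagrange/Vandermonde interpolation over `D+1` scalings `x ↦ t_k x` (`t_k = k+1 ∈ ℂ`) extracts the
  `x`-degree-`n` homogeneous component of both sides: the left side stays a weighted sum of
  products of affine forms with non-zero constant terms, now `r·(D+1)` of them
  (`finProdFinEquiv`); the right side becomes `ε^q per_n + ε^(q+1) G_n` with `G_n` HOMOGENEOUS of
  degree `n`, because the degree-`n` component of `per_n(x+u)` is `per_n(x)` (translation only
  adds lower-order terms to a form).  If `n > D` the hypothesis is contradictory (compare the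
  coefficient of a permutation monomial), so the conclusion holds vacuously.
* **`stub_rescale`** (TRUE; M/L).  Rescaling and truncated units.  With all `c_ij ≠ 0` and `G`
  homogeneous of degree `n`: write `c_ij = ε^(e_ij) w_ij`, `ε ∤ w_ij`
  (`Polynomial.exists_eq_pow_rootMultiplicity_mul_and_not_dvd`), take `N > max e_ij`, apply
  `x ↦ ε^N x` (right side: `ε^(q+Nn) per_n + ε^(q+1+Nn) G` by homogeneity), and divide factor
  `(i,j)` by `w_ij` using `w̃_ij` with `w_ij w̃_ij ≡ 1 (mod ε^M)`, `M = q + N n + 1`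
  (`IsCoprime` with `ε^M`): `c_ij + ε^N L_ij = ε^(e_ij) w_ij (1 + ε^(N−e_ij) w̃_ij L_ij) + ε^(N+M)·(…)`,
  and the error is absorbed in `G`.  Output: the LOCAL shape `Σ_i a'_i Π_j (1 + m_ij)`, `ε ∣ m_ij`,
  same `r`, same `D`.
* **`stub_gradedOfLocal`** (TRUE; M) — unchanged from birth: grading of a local expression into
  the elementary-symmetric system (`homogeneousComponent_prod_one_add`).
* **`stub_gradedESymBound`** (OPEN — the heart) — unchanged from birth; held by the lead.

All registered stub statements are written UNFOLDED and FULLY QUALIFIED (no skeleton-local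
definition occurs in them), so that a worker's Theorems file can state and prove the registered
signature verbatim with `import Mathlib` + Literature only.  §0 keeps the folded vocabulary
(`HasBorderSPS`, …) for reading; each folded predicate is definitionally the corresponding
unfolded `∃`-block.

Composition `ChowBorderBound_of` (sorry-free): translate ∘ interpolate ∘ rescale gives the birth
localisation `HasBorderSPS n r D → HasLocalBorderSPS n (r(D+1)) D`; then grade (G) and contradict
H at `2c+1` (chasm arithmetic `mul_succ_le_chasm`, tree lemma `chowToThesis_succ_le_pow`).

Disproof used: none exists for this crux (`ledger crux ls stmt-ValiantsHypothesis-5936`: only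
`Lines/birth.{lean,md}`; no `Disproof.lean`, no crux ideas, 2026-08-17).

STATUS after wave 1 (lead, 2026-08-17): T, I, R, G LANDED (p147115, p147715, p147422, p147996) and
are used BY NAME below; the only `sorry` is H.  About H, in the tree:
`FanInTwoRung.stub_gradedESymBound_fanInTwo` (rung `r ≤ 2`, p147309) and the converse transfer
`GradedOfCrux.stub_gradedESymBound_of_crux : ChowBorderBound → H` (p150241) with
`OfGraded.chowBorderBound_iff_graded : ChowBorderBound ↔ H` (p150806) — H is exactly the crux in
normal form; its open content starts at `r = 3` (see `Lines/registered.md`).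

STATUS after continuation lead c1 (prover-line-stmt-ValiantsHypothesis-5936-c1-0, 2026-08-17), all
LANDED as `--supports` of the crux (registered sub-goals), skeleton unchanged (one `sorry` = H):
* `PaddedFlattening.choose_sq_le_mul_choose_of_border` (p153720): every border `(r, D, q)`
  expression forces `C(n,k)² ≤ r·C(D,k)` for all `k ≤ n` (padded flattenings + semicontinuity);
* `PaddedFlatteningRung.chowBorderBound_paddingBelowThreeHalves` / `…_smallPadding` (p155861): the
  crux VERBATIM with the padding restricted to `D^b ≤ n^a`, `2a < 3b` (resp. `D⁴ ≤ n⁵`), all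
  `r ≤ (n+2)^(c⌊√n⌋+c)`; and `flatteningBound_consistent_in_chasm`: the flattening inequalities
  all hold at `r = 1, D = n²` (barrier certificate: flattenings cannot prove the crux);
* `NegativeDBound.chowBorderBound_false_without_DBound` (p155840, Kumar 2020: `r = 2`,
  `D = n·n!·2^n`) and `NegativeRBound.chowBorderBound_false_without_rBound` (Ryser: `r = 2^n`,
  `D = n`): both size hypotheses of the crux are necessary.
Open part of the crux after c1: padding `n^(3/2) ≲ D ≤ (n+2)^(c⌊√n⌋+c)` with `r ≥ 3` — the open
problem itself (Landsberg 2017 Cor. 7.5.3.3); line `registered` has no stub-sized piece left.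
-/

set_option linter.dupNamespace false

noncomputable section

namespace Summit.ValiantsHypothesis.ValiantsHypothesis.Cruxes.ChowBorderBound.Birth

open MvPolynomial
open Literature.Computability.AlgebraicComplexity
open scoped BigOperators Polynomial

/-! ## §0 Vocabulary (folded forms, for reading; each is definitionally its unfolded `∃`-block) -/

/-- The border target `ε^q · per_n + ε^(q+1) · G` over `ℂ[ε]` (`ε = Polynomial.X`), verbatim the
right-hand side of the crux. -/
def borderTarget (n q : ℕ) (G : MvPolynomial (Fin n × Fin n) ℂ[X]) :
    MvPolynomial (Fin n × Fin n) ℂ[X] :=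
  C (Polynomial.X ^ q) * MvPolynomial.map Polynomial.C (perPoly (Fin n) ℂ) +
    C (Polynomial.X ^ (q + 1)) * G

/-- The linear form with coefficient vector `m` (coefficients in `ℂ[ε]`). -/
def linForm {n : ℕ} (m : Fin n × Fin n → ℂ[X]) : MvPolynomial (Fin n × Fin n) ℂ[X] :=
  ∑ v, C (m v) * X v

/-- `e_d` of the `D` linear forms with coefficient vectors `m j`:
`Σ_{A ⊆ [D], |A| = d} Π_{j ∈ A} m_j`. -/
def esymForm {n D : ℕ} (d : ℕ) (m : Fin D → Fin n × Fin n → ℂ[X]) :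
    MvPolynomial (Fin n × Fin n) ℂ[X] :=
  ∑ A ∈ Finset.powersetCard d (Finset.univ : Finset (Fin D)), ∏ j ∈ A, linForm (m j)

/-- **General shape** (the crux's): a border ΣΠΣ expression of `per_n` with `r` products of `D`
affine forms over `ℂ[ε]`. -/
def HasBorderSPS (n r D : ℕ) : Prop :=
  ∃ (q : ℕ) (ℓ : Fin r → Fin D → MvPolynomial (Fin n × Fin n) ℂ[X])
    (G : MvPolynomial (Fin n × Fin n) ℂ[X]),
    (∀ i j, (ℓ i j).totalDegree ≤ 1) ∧ (∑ i, ∏ j, ℓ i j) = borderTarget n q G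

/-- **Translated shape**: weighted products of affine forms with NON-ZERO constant terms, equal to
the translate `x ↦ x + u` (`u ∈ ℂ[ε]^(n²)`) of the border target. -/
def HasTranslatedSPS (n r D : ℕ) : Prop :=
  ∃ (q : ℕ) (u : Fin n × Fin n → ℂ[X]) (a : Fin r → ℂ[X]) (c : Fin r → Fin D → ℂ[X])
    (L : Fin r → Fin D → Fin n × Fin n → ℂ[X]) (G : MvPolynomial (Fin n × Fin n) ℂ[X]),
    (∀ i j, c i j ≠ 0) ∧
      (∑ i, C (a i) * ∏ j, (C (c i j) + linForm (L i j))) =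
        aeval (fun v => X v + C (u v)) (borderTarget n q G)

/-- **Non-degenerate shape**: weighted products of affine forms with non-zero constant terms,
equal to the border target with a HOMOGENEOUS degree-`n` error term `G`. -/
def HasNondegBorderSPS (n r D : ℕ) : Prop :=
  ∃ (q : ℕ) (a : Fin r → ℂ[X]) (c : Fin r → Fin D → ℂ[X])
    (L : Fin r → Fin D → Fin n × Fin n → ℂ[X]) (G : MvPolynomial (Fin n × Fin n) ℂ[X]),
    (∀ i j, c i j ≠ 0) ∧ G.IsHomogeneous n ∧
      (∑ i, C (a i) * ∏ j, (C (c i j) + linForm (L i j))) = borderTarget n q G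

/-- **Local shape** (that of `PolyFanInLocal` / `LocalFanInTwo`): every factor is `1 + m_ij` with
all coefficients of the linear form `m_ij` divisible by `ε`. -/
def HasLocalBorderSPS (n r D : ℕ) : Prop :=
  ∃ (q : ℕ) (a : Fin r → ℂ[X]) (m : Fin r → Fin D → Fin n × Fin n → ℂ[X])
    (G : MvPolynomial (Fin n × Fin n) ℂ[X]),
    (∀ i j v, Polynomial.X ∣ m i j v) ∧
      (∑ i, C (a i) * ∏ j, (1 + linForm (m i j))) = borderTarget n q G

/-- **Graded elementary-symmetric shape**: scalars `a_i(ε)`, linear forms `m'_ij(ε)` and, degree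
by degree, `ε^d · Σ_i a_i e_d(m'_i1, …, m'_iD) = [d = n] ε^q per_n + ε^(q+1) G_d`. -/
def HasGradedESym (n r D : ℕ) : Prop :=
  ∃ (q : ℕ) (a : Fin r → ℂ[X]) (m : Fin r → Fin D → Fin n × Fin n → ℂ[X])
    (G : ℕ → MvPolynomial (Fin n × Fin n) ℂ[X]),
    ∀ d : ℕ, C (Polynomial.X ^ d) * (∑ i, C (a i) * esymForm d (m i)) =
      (if d = n then C (Polynomial.X ^ q) * MvPolynomial.map Polynomial.C (perPoly (Fin n) ℂ)
        else 0) + C (Polynomial.X ^ (q + 1)) * G d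

/-! ## §1 The stub statements as named propositions (UNFOLDED, fully qualified)

(The last name component of each `Sig.stub_*` is the registered stub's name, so that the
composition `ChowBorderBound_of` takes the declared stubs BY NAME.) -/

namespace Sig

/-- **Stub T** — generic translation (true; M). -/
def stub_translate : Prop :=
  ∀ n r D : ℕ,
    (∃ (q : ℕ) (ℓ : Fin r → Fin D → MvPolynomial (Fin n × Fin n) (Polynomial ℂ))
        (G : MvPolynomial (Fin n × Fin n) (Polynomial ℂ)),
        (∀ i j, (ℓ i j).totalDegree ≤ 1) ∧
        (∑ i, ∏ j, ℓ i j) =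
          MvPolynomial.C (Polynomial.X ^ q) *
              MvPolynomial.map Polynomial.C
                (Literature.Computability.AlgebraicComplexity.perPoly (Fin n) ℂ) +
            MvPolynomial.C (Polynomial.X ^ (q + 1)) * G) →
    ∃ (q : ℕ) (u : Fin n × Fin n → Polynomial ℂ) (a : Fin r → Polynomial ℂ)
      (c : Fin r → Fin D → Polynomial ℂ) (L : Fin r → Fin D → Fin n × Fin n → Polynomial ℂ)
      (G : MvPolynomial (Fin n × Fin n) (Polynomial ℂ)),
      (∀ i j, c i j ≠ 0) ∧
      (∑ i, MvPolynomial.C (a i) *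
          ∏ j, (MvPolynomial.C (c i j) + ∑ v, MvPolynomial.C (L i j v) * MvPolynomial.X v)) =
        MvPolynomial.aeval (fun v => MvPolynomial.X v + MvPolynomial.C (u v))
          (MvPolynomial.C (Polynomial.X ^ q) *
              MvPolynomial.map Polynomial.C
                (Literature.Computability.AlgebraicComplexity.perPoly (Fin n) ℂ) +
            MvPolynomial.C (Polynomial.X ^ (q + 1)) * G)

/-- **Stub I** — degree-`n` extraction by interpolation over `D+1` scalings (true; M/L). -/
def stub_interpolate : Prop :=
  ∀ n r D : ℕ,
    (∃ (q : ℕ) (u : Fin n × Fin n → Polynomial ℂ) (a : Fin r → Polynomial ℂ)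
        (c : Fin r → Fin D → Polynomial ℂ) (L : Fin r → Fin D → Fin n × Fin n → Polynomial ℂ)
        (G : MvPolynomial (Fin n × Fin n) (Polynomial ℂ)),
        (∀ i j, c i j ≠ 0) ∧
        (∑ i, MvPolynomial.C (a i) *
            ∏ j, (MvPolynomial.C (c i j) + ∑ v, MvPolynomial.C (L i j v) * MvPolynomial.X v)) =
          MvPolynomial.aeval (fun v => MvPolynomial.X v + MvPolynomial.C (u v))
            (MvPolynomial.C (Polynomial.X ^ q) *
                MvPolynomial.map Polynomial.C
                  (Literature.Computability.AlgebraicComplexity.perPoly (Fin n) ℂ) +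
              MvPolynomial.C (Polynomial.X ^ (q + 1)) * G)) →
    ∃ (q : ℕ) (a : Fin (r * (D + 1)) → Polynomial ℂ)
      (c : Fin (r * (D + 1)) → Fin D → Polynomial ℂ)
      (L : Fin (r * (D + 1)) → Fin D → Fin n × Fin n → Polynomial ℂ)
      (G : MvPolynomial (Fin n × Fin n) (Polynomial ℂ)),
      (∀ i j, c i j ≠ 0) ∧ G.IsHomogeneous n ∧
      (∑ i, MvPolynomial.C (a i) *
          ∏ j, (MvPolynomial.C (c i j) + ∑ v, MvPolynomial.C (L i j v) * MvPolynomial.X v)) =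
        MvPolynomial.C (Polynomial.X ^ q) *
            MvPolynomial.map Polynomial.C
              (Literature.Computability.AlgebraicComplexity.perPoly (Fin n) ℂ) +
          MvPolynomial.C (Polynomial.X ^ (q + 1)) * G

/-- **Stub R** — rescaling `x ↦ ε^N x` and truncated units (true; M/L). -/
def stub_rescale : Prop :=
  ∀ n r D : ℕ,
    (∃ (q : ℕ) (a : Fin r → Polynomial ℂ) (c : Fin r → Fin D → Polynomial ℂ)
        (L : Fin r → Fin D → Fin n × Fin n → Polynomial ℂ)
        (G : MvPolynomial (Fin n × Fin n) (Polynomial ℂ)),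
        (∀ i j, c i j ≠ 0) ∧ G.IsHomogeneous n ∧
        (∑ i, MvPolynomial.C (a i) *
            ∏ j, (MvPolynomial.C (c i j) + ∑ v, MvPolynomial.C (L i j v) * MvPolynomial.X v)) =
          MvPolynomial.C (Polynomial.X ^ q) *
              MvPolynomial.map Polynomial.C
                (Literature.Computability.AlgebraicComplexity.perPoly (Fin n) ℂ) +
            MvPolynomial.C (Polynomial.X ^ (q + 1)) * G) →
    ∃ (q : ℕ) (a : Fin r → Polynomial ℂ) (m : Fin r → Fin D → Fin n × Fin n → Polynomial ℂ)
      (G : MvPolynomial (Fin n × Fin n) (Polynomial ℂ)),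
      (∀ i j v, Polynomial.X ∣ m i j v) ∧
      (∑ i, MvPolynomial.C (a i) *
          ∏ j, (1 + ∑ v, MvPolynomial.C (m i j v) * MvPolynomial.X v)) =
        MvPolynomial.C (Polynomial.X ^ q) *
            MvPolynomial.map Polynomial.C
              (Literature.Computability.AlgebraicComplexity.perPoly (Fin n) ℂ) +
          MvPolynomial.C (Polynomial.X ^ (q + 1)) * G

/-- **Stub G** — grading of a local expression into the elementary-symmetric system (true; M). -/
def stub_gradedOfLocal : Prop :=
  ∀ n r D : ℕ,
    (∃ (q : ℕ) (a : Fin r → Polynomial ℂ) (m : Fin r → Fin D → Fin n × Fin n → Polynomial ℂ)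
        (G : MvPolynomial (Fin n × Fin n) (Polynomial ℂ)),
        (∀ i j v, Polynomial.X ∣ m i j v) ∧
        (∑ i, MvPolynomial.C (a i) *
            ∏ j, (1 + ∑ v, MvPolynomial.C (m i j v) * MvPolynomial.X v)) =
          MvPolynomial.C (Polynomial.X ^ q) *
              MvPolynomial.map Polynomial.C
                (Literature.Computability.AlgebraicComplexity.perPoly (Fin n) ℂ) +
            MvPolynomial.C (Polynomial.X ^ (q + 1)) * G) →
    ∃ (q : ℕ) (a : Fin r → Polynomial ℂ) (m : Fin r → Fin D → Fin n × Fin n → Polynomial ℂ)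
      (G : ℕ → MvPolynomial (Fin n × Fin n) (Polynomial ℂ)),
      ∀ d : ℕ, MvPolynomial.C (Polynomial.X ^ d) *
          (∑ i, MvPolynomial.C (a i) *
            ∑ A ∈ Finset.powersetCard d (Finset.univ : Finset (Fin D)),
              ∏ j ∈ A, ∑ v, MvPolynomial.C (m i j v) * MvPolynomial.X v) =
        (if d = n then
            MvPolynomial.C (Polynomial.X ^ q) *
              MvPolynomial.map Polynomial.C
                (Literature.Computability.AlgebraicComplexity.perPoly (Fin n) ℂ)
          else 0) +
          MvPolynomial.C (Polynomial.X ^ (q + 1)) * G d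

/-- **Stub H** — no graded elementary-symmetric system in the chasm range (OPEN; the heart). -/
def stub_gradedESymBound : Prop :=
  ∀ c : ℕ, ∃ n₀ : ℕ, ∀ n ≥ n₀, ∀ r D : ℕ, r ≤ (n + 2) ^ (c * Nat.sqrt n + c) →
    D ≤ (n + 2) ^ (c * Nat.sqrt n + c) →
    ¬ ∃ (q : ℕ) (a : Fin r → Polynomial ℂ) (m : Fin r → Fin D → Fin n × Fin n → Polynomial ℂ)
        (G : ℕ → MvPolynomial (Fin n × Fin n) (Polynomial ℂ)),
        ∀ d : ℕ, MvPolynomial.C (Polynomial.X ^ d) *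
            (∑ i, MvPolynomial.C (a i) *
              ∑ A ∈ Finset.powersetCard d (Finset.univ : Finset (Fin D)),
                ∏ j ∈ A, ∑ v, MvPolynomial.C (m i j v) * MvPolynomial.X v) =
          (if d = n then
              MvPolynomial.C (Polynomial.X ^ q) *
                MvPolynomial.map Polynomial.C
                  (Literature.Computability.AlgebraicComplexity.perPoly (Fin n) ℂ)
            else 0) +
            MvPolynomial.C (Polynomial.X ^ (q + 1)) * G d

end Sig

/-! ## §2 The registered stubs (statements spelled out; `sorry` lives only here) -/

/-- **Stub T (registered)** — GENERIC TRANSLATION: a border ΣΠΣ expression of `per_n` becomes,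
after `x ↦ x + u` for a generic `u ∈ ℂ[ε]^(n²)`, a weighted sum of `r` products of `D` affine
forms all of whose constant terms are non-zero, equal to the translate of the border target.
Size M. -/
theorem stub_translate :
    ∀ n r D : ℕ,
    (∃ (q : ℕ) (ℓ : Fin r → Fin D → MvPolynomial (Fin n × Fin n) (Polynomial ℂ))
        (G : MvPolynomial (Fin n × Fin n) (Polynomial ℂ)),
        (∀ i j, (ℓ i j).totalDegree ≤ 1) ∧
        (∑ i, ∏ j, ℓ i j) =
          MvPolynomial.C (Polynomial.X ^ q) *
              MvPolynomial.map Polynomial.C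
                (Literature.Computability.AlgebraicComplexity.perPoly (Fin n) ℂ) +
            MvPolynomial.C (Polynomial.X ^ (q + 1)) * G) →
    ∃ (q : ℕ) (u : Fin n × Fin n → Polynomial ℂ) (a : Fin r → Polynomial ℂ)
      (c : Fin r → Fin D → Polynomial ℂ) (L : Fin r → Fin D → Fin n × Fin n → Polynomial ℂ)
      (G : MvPolynomial (Fin n × Fin n) (Polynomial ℂ)),
      (∀ i j, c i j ≠ 0) ∧
      (∑ i, MvPolynomial.C (a i) *
          ∏ j, (MvPolynomial.C (c i j) + ∑ v, MvPolynomial.C (L i j v) * MvPolynomial.X v)) =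
        MvPolynomial.aeval (fun v => MvPolynomial.X v + MvPolynomial.C (u v))
          (MvPolynomial.C (Polynomial.X ^ q) *
              MvPolynomial.map Polynomial.C
                (Literature.Computability.AlgebraicComplexity.perPoly (Fin n) ℂ) +
            MvPolynomial.C (Polynomial.X ^ (q + 1)) * G) :=
  -- LANDED (wave 1, p147115): stub-worker file `Theorems/ChowBorderDepth3ChowBorderBoundStubTranslate.lean`
  Summit.ValiantsHypothesis.ValiantsHypothesis.Theorems.ChowBorderBound.Translate.stub_translate

/-- **Stub I (registered)** — DEGREE-`n` EXTRACTION: from the translated identity, interpolation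
over `D+1` scalings `x ↦ t_k x` yields `r·(D+1)` weighted products of affine forms with non-zero
constant terms summing to `ε^q per_n + ε^(q+1) G` with `G` homogeneous of degree `n`.
Size M/L. -/
theorem stub_interpolate :
    ∀ n r D : ℕ,
    (∃ (q : ℕ) (u : Fin n × Fin n → Polynomial ℂ) (a : Fin r → Polynomial ℂ)
        (c : Fin r → Fin D → Polynomial ℂ) (L : Fin r → Fin D → Fin n × Fin n → Polynomial ℂ)
        (G : MvPolynomial (Fin n × Fin n) (Polynomial ℂ)),
        (∀ i j, c i j ≠ 0) ∧
        (∑ i, MvPolynomial.C (a i) *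
            ∏ j, (MvPolynomial.C (c i j) + ∑ v, MvPolynomial.C (L i j v) * MvPolynomial.X v)) =
          MvPolynomial.aeval (fun v => MvPolynomial.X v + MvPolynomial.C (u v))
            (MvPolynomial.C (Polynomial.X ^ q) *
                MvPolynomial.map Polynomial.C
                  (Literature.Computability.AlgebraicComplexity.perPoly (Fin n) ℂ) +
              MvPolynomial.C (Polynomial.X ^ (q + 1)) * G)) →
    ∃ (q : ℕ) (a : Fin (r * (D + 1)) → Polynomial ℂ)
      (c : Fin (r * (D + 1)) → Fin D → Polynomial ℂ)
      (L : Fin (r * (D + 1)) → Fin D → Fin n × Fin n → Polynomial ℂ)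
      (G : MvPolynomial (Fin n × Fin n) (Polynomial ℂ)),
      (∀ i j, c i j ≠ 0) ∧ G.IsHomogeneous n ∧
      (∑ i, MvPolynomial.C (a i) *
          ∏ j, (MvPolynomial.C (c i j) + ∑ v, MvPolynomial.C (L i j v) * MvPolynomial.X v)) =
        MvPolynomial.C (Polynomial.X ^ q) *
            MvPolynomial.map Polynomial.C
              (Literature.Computability.AlgebraicComplexity.perPoly (Fin n) ℂ) +
          MvPolynomial.C (Polynomial.X ^ (q + 1)) * G :=
  -- LANDED (wave 1): stub-worker file `Theorems/ChowBorderDepth3ChowBorderBoundStubInterpolate.lean`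
  Summit.ValiantsHypothesis.ValiantsHypothesis.Theorems.ChowBorderBound.Interpolate.stub_interpolate

/-- **Stub R (registered)** — RESCALING AND TRUNCATED UNITS: a non-degenerate expression (all
constant terms non-zero, homogeneous error term) becomes a LOCAL one (`Π_j (1 + m_ij)`, `ε ∣ m_ij`)
with the same `r` and `D`, via `x ↦ ε^N x` and inverses of the unit parts of the constant terms
truncated modulo `ε^(q+Nn+1)`.  Size M/L. -/
theorem stub_rescale :
    ∀ n r D : ℕ,
    (∃ (q : ℕ) (a : Fin r → Polynomial ℂ) (c : Fin r → Fin D → Polynomial ℂ)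
        (L : Fin r → Fin D → Fin n × Fin n → Polynomial ℂ)
        (G : MvPolynomial (Fin n × Fin n) (Polynomial ℂ)),
        (∀ i j, c i j ≠ 0) ∧ G.IsHomogeneous n ∧
        (∑ i, MvPolynomial.C (a i) *
            ∏ j, (MvPolynomial.C (c i j) + ∑ v, MvPolynomial.C (L i j v) * MvPolynomial.X v)) =
          MvPolynomial.C (Polynomial.X ^ q) *
              MvPolynomial.map Polynomial.C
                (Literature.Computability.AlgebraicComplexity.perPoly (Fin n) ℂ) +
            MvPolynomial.C (Polynomial.X ^ (q + 1)) * G) →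
    ∃ (q : ℕ) (a : Fin r → Polynomial ℂ) (m : Fin r → Fin D → Fin n × Fin n → Polynomial ℂ)
      (G : MvPolynomial (Fin n × Fin n) (Polynomial ℂ)),
      (∀ i j v, Polynomial.X ∣ m i j v) ∧
      (∑ i, MvPolynomial.C (a i) *
          ∏ j, (1 + ∑ v, MvPolynomial.C (m i j v) * MvPolynomial.X v)) =
        MvPolynomial.C (Polynomial.X ^ q) *
            MvPolynomial.map Polynomial.C
              (Literature.Computability.AlgebraicComplexity.perPoly (Fin n) ℂ) +
          MvPolynomial.C (Polynomial.X ^ (q + 1)) * G :=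
  -- LANDED (wave 1, p147422): stub-worker file `Theorems/ChowBorderDepth3ChowBorderBoundStubRescale.lean`
  Summit.ValiantsHypothesis.ValiantsHypothesis.Theorems.ChowBorderBound.Rescale.stub_rescale

/-- **Stub G (registered)** — GRADING: a local border expression with data `(q, a, m = ε m')`
gives the graded elementary-symmetric system for `(q, a, m')`: the `x`-degree-`d` component of
`Σ_i a_i Π_j (1 + ε m'_ij)` is `ε^d Σ_i a_i e_d(m'_i)` (`homogeneousComponent_prod_one_add`),
that of the target is `[d = n] ε^q per_n + ε^(q+1) G_d`.  Size M. -/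
theorem stub_gradedOfLocal :
    ∀ n r D : ℕ,
    (∃ (q : ℕ) (a : Fin r → Polynomial ℂ) (m : Fin r → Fin D → Fin n × Fin n → Polynomial ℂ)
        (G : MvPolynomial (Fin n × Fin n) (Polynomial ℂ)),
        (∀ i j v, Polynomial.X ∣ m i j v) ∧
        (∑ i, MvPolynomial.C (a i) *
            ∏ j, (1 + ∑ v, MvPolynomial.C (m i j v) * MvPolynomial.X v)) =
          MvPolynomial.C (Polynomial.X ^ q) *
              MvPolynomial.map Polynomial.C
                (Literature.Computability.AlgebraicComplexity.perPoly (Fin n) ℂ) +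
            MvPolynomial.C (Polynomial.X ^ (q + 1)) * G) →
    ∃ (q : ℕ) (a : Fin r → Polynomial ℂ) (m : Fin r → Fin D → Fin n × Fin n → Polynomial ℂ)
      (G : ℕ → MvPolynomial (Fin n × Fin n) (Polynomial ℂ)),
      ∀ d : ℕ, MvPolynomial.C (Polynomial.X ^ d) *
          (∑ i, MvPolynomial.C (a i) *
            ∑ A ∈ Finset.powersetCard d (Finset.univ : Finset (Fin D)),
              ∏ j ∈ A, ∑ v, MvPolynomial.C (m i j v) * MvPolynomial.X v) =
        (if d = n then
            MvPolynomial.C (Polynomial.X ^ q) *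
              MvPolynomial.map Polynomial.C
                (Literature.Computability.AlgebraicComplexity.perPoly (Fin n) ℂ)
          else 0) +
          MvPolynomial.C (Polynomial.X ^ (q + 1)) * G d :=
  -- LANDED (wave 1): stub-worker file `Theorems/ChowBorderDepth3ChowBorderBoundStubGradedOfLocal.lean`
  Summit.ValiantsHypothesis.ValiantsHypothesis.Theorems.ChowBorderBound.GradedOfLocal.stub_gradedOfLocal

/-- **Stub H (registered)** — THE HEART (open): for every `c`, for all large `n` and all
`r, D ≤ (n+2)^(c⌊√n⌋+c)`, there are no scalars `a_i(ε)`, linear forms `m'_ij(ε)` (`i < r`,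
`j < D`) and `q` with `ε^d Σ_i a_i e_d(m'_i1, …, m'_iD) ≡ [d = n] ε^q per_n (mod ε^(q+1))` for
every degree `d`.  Rungs: `r = 2` is `LocalFanInTwo` (proved), `r ≤ n^k + k` is `PolyFanInLocal`. -/
theorem stub_gradedESymBound :
    ∀ c : ℕ, ∃ n₀ : ℕ, ∀ n ≥ n₀, ∀ r D : ℕ, r ≤ (n + 2) ^ (c * Nat.sqrt n + c) →
    D ≤ (n + 2) ^ (c * Nat.sqrt n + c) →
    ¬ ∃ (q : ℕ) (a : Fin r → Polynomial ℂ) (m : Fin r → Fin D → Fin n × Fin n → Polynomial ℂ)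
        (G : ℕ → MvPolynomial (Fin n × Fin n) (Polynomial ℂ)),
        ∀ d : ℕ, MvPolynomial.C (Polynomial.X ^ d) *
            (∑ i, MvPolynomial.C (a i) *
              ∑ A ∈ Finset.powersetCard d (Finset.univ : Finset (Fin D)),
                ∏ j ∈ A, ∑ v, MvPolynomial.C (m i j v) * MvPolynomial.X v) =
          (if d = n then
              MvPolynomial.C (Polynomial.X ^ q) *
                MvPolynomial.map Polynomial.C
                  (Literature.Computability.AlgebraicComplexity.perPoly (Fin n) ℂ)
            else 0) +
            MvPolynomial.C (Polynomial.X ^ (q + 1)) * G d := by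
  sorry

/-! ## §3 Composition (sorry-free) and calibration -/

/-- The three localisation stubs compose to the birth skeleton's localisation step
`HasBorderSPS n r D → HasLocalBorderSPS n (r·(D+1)) D` (all predicates unfold definitionally to
the stubs' `∃`-blocks). -/
theorem stub_localisation_of (hT : Sig.stub_translate) (hI : Sig.stub_interpolate)
    (hR : Sig.stub_rescale) :
    ∀ n r D : ℕ, HasBorderSPS n r D → HasLocalBorderSPS n (r * (D + 1)) D :=
  fun n r D h => hR n (r * (D + 1)) D (hI n r D (hT n r D h))

/-- Grading, folded: `HasLocalBorderSPS n r D → HasGradedESym n r D` is stub G. -/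
theorem hasGradedESym_of_local (hG : Sig.stub_gradedOfLocal) :
    ∀ n r D : ℕ, HasLocalBorderSPS n r D → HasGradedESym n r D :=
  fun n r D h => hG n r D h

/-- Arithmetic of the chasm range: `r, D ≤ (n+2)^(c⌊√n⌋+c)` gives
`r·(D+1) ≤ (n+2)^((2c+1)⌊√n⌋+(2c+1))`. -/
theorem mul_succ_le_chasm {n c r D : ℕ} (hr : r ≤ (n + 2) ^ (c * Nat.sqrt n + c))
    (hD : D ≤ (n + 2) ^ (c * Nat.sqrt n + c)) :
    r * (D + 1) ≤ (n + 2) ^ ((2 * c + 1) * Nat.sqrt n + (2 * c + 1)) := by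
  have hD1 : D + 1 ≤ (n + 2) ^ ((c + 1) * Nat.sqrt n + (c + 1)) :=
    Summit.ValiantsHypothesis.ValiantsHypothesis.Theorems.chowToThesis_succ_le_pow hD
  calc r * (D + 1)
      ≤ (n + 2) ^ (c * Nat.sqrt n + c) * (n + 2) ^ ((c + 1) * Nat.sqrt n + (c + 1)) :=
        Nat.mul_le_mul hr hD1
    _ = (n + 2) ^ ((2 * c + 1) * Nat.sqrt n + (2 * c + 1)) := by
        rw [← pow_add]; congr 1; ring

/-- Monotonicity of the chasm bound in `c`. -/
theorem chasm_mono {n c : ℕ} :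
    (n + 2) ^ (c * Nat.sqrt n + c) ≤ (n + 2) ^ ((2 * c + 1) * Nat.sqrt n + (2 * c + 1)) :=
  Nat.pow_le_pow_right (by omega) (by nlinarith [Nat.zero_le (Nat.sqrt n), Nat.zero_le c])

/-- **The line closes the crux**: translation (T) + interpolation (I) + rescaling (R) — the
localisation at the vertex — then grading (G) and the graded bound (H) give
`ChowBorderDepth3.ChowBorderBound`, at threshold `n₀(2c+1) + 1`. -/
theorem ChowBorderBound_of :
    Sig.stub_translate → Sig.stub_interpolate → Sig.stub_rescale → Sig.stub_gradedOfLocal →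
      Sig.stub_gradedESymBound →
      Summit.ValiantsHypothesis.ValiantsHypothesis.Theses.ChowBorderDepth3.ChowBorderBound := by
  intro hT hI hR hG hH c
  obtain ⟨n₀, hn₀⟩ := hH (2 * c + 1)
  refine ⟨n₀ + 1, fun n hn r D hr hD hex => ?_⟩
  have hsps : HasBorderSPS n r D := by
    obtain ⟨q, ℓ, G, hdeg, hsum⟩ := hex
    exact ⟨q, ℓ, G, hdeg, hsum⟩
  have hloc : HasLocalBorderSPS n (r * (D + 1)) D := stub_localisation_of hT hI hR n r D hsps
  have hgr : HasGradedESym n (r * (D + 1)) D := hasGradedESym_of_local hG n (r * (D + 1)) D hloc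
  exact hn₀ n (by omega) (r * (D + 1)) D (mul_succ_le_chasm hr hD) (hD.trans chasm_mono) hgr

/-- **The skeleton**: `ChowBorderDepth3.ChowBorderBound` BY NAME, modulo exactly the five
registered stubs. -/
theorem ChowBorderBound_proof :
    Summit.ValiantsHypothesis.ValiantsHypothesis.Theses.ChowBorderDepth3.ChowBorderBound :=
  ChowBorderBound_of stub_translate stub_interpolate stub_rescale stub_gradedOfLocal
    stub_gradedESymBound

/-- **Calibration (proved, not a stub)**: Ryser's formula is a local border expression of `per_n`
with `2^n` summands and `D = n` factors (tree theorem `exists_local_ryser_perPoly`), so the local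
shape is inhabited for `per_n` just above the chasm range and stub H is not vacuously true. -/
theorem hasLocalBorderSPS_ryser (n : ℕ) : HasLocalBorderSPS n (2 ^ n) n := by
  obtain ⟨q, a, m, G, hm, hsum⟩ :=
    Summit.ValiantsHypothesis.ValiantsHypothesis.Theorems.exists_local_ryser_perPoly n
  exact ⟨q, a, m, G, hm, hsum⟩

/-- **Calibration of the graded shape (proved)** at `n = 1`, `r = 2`, `D = 1` (`per_1 = x`):
the local identity `(1 + εx) − 1 = ε·x` graded — `a = (1, −1)`, `m'_0 = x`, `m'_1 = 0`, `q = 1`,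
`G = 0`: degree `0` reads `1 − 1 = 0`, degree `1` reads `ε·x = ε·per_1`, degrees `≥ 2` are empty.
So `HasGradedESym` computes and is inhabited in kind (it is refutable only through the size bounds). -/
theorem hasGradedESym_one : HasGradedESym 1 2 1 := by
  classical
  refine ⟨1, ![1, -1], ![fun _ _ => 1, fun _ _ => 0], fun _ => 0, fun d => ?_⟩
  have hper : MvPolynomial.map Polynomial.C (perPoly (Fin 1) ℂ) =
      (X ((0 : Fin 1), (0 : Fin 1)) : MvPolynomial (Fin 1 × Fin 1) ℂ[X]) := by
    rw [map_perPoly]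
    simp [perPoly, Matrix.permanent, Matrix.mvPolynomialX]
  have hlin1 : linForm (fun _ : Fin 1 × Fin 1 => (1 : ℂ[X])) =
      (X ((0 : Fin 1), (0 : Fin 1)) : MvPolynomial (Fin 1 × Fin 1) ℂ[X]) := by
    simp only [linForm, Fintype.sum_prod_type, Fin.sum_univ_one, map_one, one_mul]
  have hlin0 : linForm (fun _ : Fin 1 × Fin 1 => (0 : ℂ[X])) = 0 := by simp [linForm]
  rcases Nat.lt_trichotomy d 1 with hd | rfl | hd
  · obtain rfl : d = 0 := by omega
    simp [esymForm]
  · have h1' : Finset.powersetCard 1 ({0} : Finset (Fin 1)) = {{0}} := by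
      simpa using Finset.powersetCard_self ({0} : Finset (Fin 1))
    simp [esymForm, hlin1, hlin0, hper, h1']
  · have h2' : Finset.powersetCard d ({0} : Finset (Fin 1)) = ∅ :=
      Finset.powersetCard_eq_empty.2 (by simpa using hd)
    simp [esymForm, h2', show d ≠ 1 by omega]


/-! ## §4 Rungs along the TOP-FAN-IN axis, in the crux's own vocabulary (lead c2, 2026-08-17)

The graded form H multiplies the top fan-in by `D + 1` (interpolation), so its `r ≤ 2` rung
(`FanInTwoRung`) says nothing about the CRUX at fixed `r`.  The rungs below are stated for the
crux's own shape `Σ_{i<r} Π_{j<D} ℓ_ij = ε^q per_n + ε^(q+1) G` (affine `ℓ_ij` over `ℂ[ε]`), with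
NO size bound on `D` or `q`:

* `stub_goodPerm` (P, combinatorics; LANDED p159685) + `stub_coeffGraphSubst` (Q, one coefficient;
  LANDED p159479) ⟹
  `PermNonvanishing`: the permanent of a matrix of indeterminates in which FEWER THAN `n` entries
  have been replaced by arbitrary polynomials still has a permutation monomial with coefficient
  `1`; in particular `per_n` vanishes on no linear subspace cut out by `< n` linear forms and is
  constant on no affine subspace of codimension `< n` (the classical base of every bounded-fan-in
  case of the crux);
* `stub_fanInBelowN` (C; LANDED p159750): hence `per_n` has NO exact ΣΠΣ expression over `ℂ` with top fan-in
  `r < n`, of any degree `D` (flag of hyperplane restrictions; the crux's `q = 0`, `r < n` slice);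
* `stub_borderFanInOne` (B; LANDED p160177): the crux at `r ≤ 1` — a border product of affine forms over `ℂ[ε]`
  degenerates to a product of affine forms over `ℂ` (ε-adic normalisation factor by factor), and
  `per_n` (irreducible, degree `n ≥ 2`) is not one.

The `r = 2` rung of the crux (Kumar's theorem is tight for `per_n` even for NON-local two-summand
border expressions: `D ≥ 2^{Ω(n)}`) is the lead's own stub, by the exact divide–derive calculus
over `ℂ(x)((ε))`; see `Lines/registered.md` §c2. -/

namespace Sig

/-- **Stub P** — pivot-avoiding permutation with a compatible column ranking (true; S/M):
with fewer than `n` pivot cells `P`, some permutation `σ` avoids `P`, and the columns can be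
ranked injectively so that for every pivot `(r, c)` the column `σ⁻¹ r` carrying row `r` is ranked
strictly after `c` (order pivot rows first; Hall's theorem for the pivot columns). -/
def stub_goodPerm : Prop :=
  ∀ (n : ℕ) (P : Finset (Fin n × Fin n)), P.card < n →
    ∃ (σ : Equiv.Perm (Fin n)) (rk : Fin n → ℕ), Function.Injective rk ∧
      (∀ i : Fin n, (σ i, i) ∉ P) ∧ ∀ p ∈ P, rk p.2 < rk (σ.symm p.1)

/-- **Stub Q** — the coefficient of the good permutation monomial is `1` (true; M): after
replacing the pivot entries `X_p`, `p ∈ P`, of the generic matrix by ARBITRARY polynomials `g p`,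
the monomial `Π_i X_{(σ i, i)}` of a permutation `σ` as in stub P has coefficient exactly `1` in the
permanent: for `τ ≠ σ` the cells of `τ` outside `P` would have to be cells of `σ`, so `τ = σ` off
the set `I ≠ ∅` of columns where `τ` meets `P`, `τ(I) = σ(I)`, and `c ↦ σ⁻¹ (τ c)` would be a
rank-increasing bijection of `I`. -/
def stub_coeffGraphSubst : Prop :=
  ∀ (n : ℕ) (P : Finset (Fin n × Fin n))
    (g : Fin n × Fin n → MvPolynomial (Fin n × Fin n) ℂ) (σ : Equiv.Perm (Fin n))
    (rk : Fin n → ℕ), Function.Injective rk → (∀ i : Fin n, (σ i, i) ∉ P) →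
    (∀ p ∈ P, rk p.2 < rk (σ.symm p.1)) →
    MvPolynomial.coeff (∑ i : Fin n, Finsupp.single (σ i, i) (1 : ℕ))
      (MvPolynomial.aeval
        (fun v : Fin n × Fin n =>
          if v ∈ P then g v else (MvPolynomial.X v : MvPolynomial (Fin n × Fin n) ℂ))
        (Literature.Computability.AlgebraicComplexity.perPoly (Fin n) ℂ)) = 1

/-- **Stub C** — no exact ΣΠΣ expression of `per_n` with top fan-in below `n` (true; M), stated
as an implication from `PermNonvanishing` (spelled out): restrict to a non-constant factor of the
last gate (`X_u ↦` the affine expression solving it), which kills that gate and replaces at most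
one more generic entry by an affine polynomial; after `r < n` steps `per_n` with `< n` entries
substituted would be a constant. -/
def stub_fanInBelowN : Prop :=
  (∀ (n : ℕ) (P : Finset (Fin n × Fin n))
      (g : Fin n × Fin n → MvPolynomial (Fin n × Fin n) ℂ) (c : ℂ), P.card < n →
      MvPolynomial.aeval
          (fun v : Fin n × Fin n =>
            if v ∈ P then g v else (MvPolynomial.X v : MvPolynomial (Fin n × Fin n) ℂ))
          (Literature.Computability.AlgebraicComplexity.perPoly (Fin n) ℂ) ≠
        MvPolynomial.C c) →
    ∀ (n r D : ℕ), r < n → ∀ (ℓ : Fin r → Fin D → MvPolynomial (Fin n × Fin n) ℂ),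
      (∀ i j, (ℓ i j).totalDegree ≤ 1) →
      (∑ i, ∏ j, ℓ i j) ≠ Literature.Computability.AlgebraicComplexity.perPoly (Fin n) ℂ

/-- **Stub B** — the crux at top fan-in `1`, every `D` and `q` (true; M): a single border
product of affine forms over `ℂ[ε]` never equals `ε^q per_n + ε^(q+1) G` for `n ≥ 2`
(normalise each factor by its ε-adic order; the orders add up to `q`; reducing mod `ε` writes
`per_n` as a product of `D` affine forms over `ℂ`, contradicting `perPoly_irreducible` and
`deg per_n = n ≥ 2`). -/
def stub_borderFanInOne : Prop :=
  ∀ n : ℕ, 2 ≤ n → ∀ (D q : ℕ) (ℓ : Fin D → MvPolynomial (Fin n × Fin n) (Polynomial ℂ))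
    (G : MvPolynomial (Fin n × Fin n) (Polynomial ℂ)), (∀ j, (ℓ j).totalDegree ≤ 1) →
    (∏ j, ℓ j) ≠
      MvPolynomial.C (Polynomial.X ^ q) *
          MvPolynomial.map Polynomial.C
            (Literature.Computability.AlgebraicComplexity.perPoly (Fin n) ℂ) +
        MvPolynomial.C (Polynomial.X ^ (q + 1)) * G

end Sig

/-- **Stub P** (registered): pivot-avoiding permutation with a compatible column ranking. -/
theorem stub_goodPerm :
    ∀ (n : ℕ) (P : Finset (Fin n × Fin n)), P.card < n →
    ∃ (σ : Equiv.Perm (Fin n)) (rk : Fin n → ℕ), Function.Injective rk ∧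
      (∀ i : Fin n, (σ i, i) ∉ P) ∧ ∀ p ∈ P, rk p.2 < rk (σ.symm p.1) :=
  Summit.ValiantsHypothesis.ValiantsHypothesis.Theorems.ChowBorderBound.GoodPerm.stub_goodPerm

/-- **Stub Q** (registered): the good permutation monomial keeps coefficient `1` under any
substitution of the pivot entries. -/
theorem stub_coeffGraphSubst :
    ∀ (n : ℕ) (P : Finset (Fin n × Fin n))
    (g : Fin n × Fin n → MvPolynomial (Fin n × Fin n) ℂ) (σ : Equiv.Perm (Fin n))
    (rk : Fin n → ℕ), Function.Injective rk → (∀ i : Fin n, (σ i, i) ∉ P) →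
    (∀ p ∈ P, rk p.2 < rk (σ.symm p.1)) →
    MvPolynomial.coeff (∑ i : Fin n, Finsupp.single (σ i, i) (1 : ℕ))
      (MvPolynomial.aeval
        (fun v : Fin n × Fin n =>
          if v ∈ P then g v else (MvPolynomial.X v : MvPolynomial (Fin n × Fin n) ℂ))
        (Literature.Computability.AlgebraicComplexity.perPoly (Fin n) ℂ)) = 1 :=
  Summit.ValiantsHypothesis.ValiantsHypothesis.Theorems.ChowBorderBound.CoeffGraphSubst.stub_coeffGraphSubst

/-- **Stub C** (registered): `PermNonvanishing` ⟹ no exact ΣΠΣ expression of `per_n` with top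
fan-in `r < n`. -/
theorem stub_fanInBelowN :
    (∀ (n : ℕ) (P : Finset (Fin n × Fin n))
      (g : Fin n × Fin n → MvPolynomial (Fin n × Fin n) ℂ) (c : ℂ), P.card < n →
      MvPolynomial.aeval
          (fun v : Fin n × Fin n =>
            if v ∈ P then g v else (MvPolynomial.X v : MvPolynomial (Fin n × Fin n) ℂ))
          (Literature.Computability.AlgebraicComplexity.perPoly (Fin n) ℂ) ≠
        MvPolynomial.C c) →
    ∀ (n r D : ℕ), r < n → ∀ (ℓ : Fin r → Fin D → MvPolynomial (Fin n × Fin n) ℂ),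
      (∀ i j, (ℓ i j).totalDegree ≤ 1) →
      (∑ i, ∏ j, ℓ i j) ≠ Literature.Computability.AlgebraicComplexity.perPoly (Fin n) ℂ :=
  Summit.ValiantsHypothesis.ValiantsHypothesis.Theorems.ChowBorderBound.FanInBelowN.stub_fanInBelowN

/-- **Stub B** (registered): the crux at top fan-in `1`, every `D` and `q`. -/
theorem stub_borderFanInOne :
    ∀ n : ℕ, 2 ≤ n → ∀ (D q : ℕ) (ℓ : Fin D → MvPolynomial (Fin n × Fin n) (Polynomial ℂ))
    (G : MvPolynomial (Fin n × Fin n) (Polynomial ℂ)), (∀ j, (ℓ j).totalDegree ≤ 1) →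
    (∏ j, ℓ j) ≠
      MvPolynomial.C (Polynomial.X ^ q) *
          MvPolynomial.map Polynomial.C
            (Literature.Computability.AlgebraicComplexity.perPoly (Fin n) ℂ) +
        MvPolynomial.C (Polynomial.X ^ (q + 1)) * G :=
  Summit.ValiantsHypothesis.ValiantsHypothesis.Theorems.ChowBorderBound.BorderFanInOne.stub_borderFanInOne

/-! ### §4.1 Glue (sorry-free): the rungs from the stubs -/

/-- **PermNonvanishing** (from stubs P and Q): replacing fewer than `n` entries of the generic
`n × n` matrix by arbitrary polynomials never makes the permanent a constant. -/
theorem permNonvanishing_of (hP : Sig.stub_goodPerm) (hQ : Sig.stub_coeffGraphSubst) :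
    ∀ (n : ℕ) (P : Finset (Fin n × Fin n))
      (g : Fin n × Fin n → MvPolynomial (Fin n × Fin n) ℂ) (c : ℂ), P.card < n →
      MvPolynomial.aeval
          (fun v : Fin n × Fin n =>
            if v ∈ P then g v else (MvPolynomial.X v : MvPolynomial (Fin n × Fin n) ℂ))
          (Literature.Computability.AlgebraicComplexity.perPoly (Fin n) ℂ) ≠
        MvPolynomial.C c := by
  intro n P g c hcard heq
  obtain ⟨σ, rk, hrk, hσ, hlt⟩ := hP n P hcard
  have h1 := hQ n P g σ rk hrk hσ hlt
  rw [heq, MvPolynomial.coeff_C] at h1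
  have hn : 0 < n := lt_of_le_of_lt (Nat.zero_le _) hcard
  have hm : (0 : Fin n × Fin n →₀ ℕ) ≠ ∑ i : Fin n, Finsupp.single (σ i, i) (1 : ℕ) := by
    intro h0
    have h2 := congrArg (fun f : Fin n × Fin n →₀ ℕ => f (σ ⟨0, hn⟩, ⟨0, hn⟩)) h0
    simp only [Finsupp.coe_zero, Pi.zero_apply, Finsupp.coe_finsetSum, Finset.sum_apply] at h2
    have h3 : (1 : ℕ) ≤ ∑ i : Fin n, (Finsupp.single (σ i, i) (1 : ℕ)) (σ ⟨0, hn⟩, ⟨0, hn⟩) :=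
      le_trans (by simp) (Finset.single_le_sum (f := fun i : Fin n =>
        (Finsupp.single (σ i, i) (1 : ℕ)) (σ ⟨0, hn⟩, ⟨0, hn⟩)) (fun _ _ => Nat.zero_le _)
        (Finset.mem_univ (⟨0, hn⟩ : Fin n)))
    omega
  rw [if_neg hm] at h1
  exact zero_ne_one h1

/-- **Rung (exact, `r < n`)**: `per_n` has no exact ΣΠΣ expression over `ℂ` with top fan-in
below `n` — the crux's `q = 0` slice below fan-in `n`, for every `D`. -/
theorem perPoly_ne_sps_of_lt (hP : Sig.stub_goodPerm) (hQ : Sig.stub_coeffGraphSubst)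
    (hC : Sig.stub_fanInBelowN) :
    ∀ (n r D : ℕ), r < n → ∀ (ℓ : Fin r → Fin D → MvPolynomial (Fin n × Fin n) ℂ),
      (∀ i j, (ℓ i j).totalDegree ≤ 1) →
      (∑ i, ∏ j, ℓ i j) ≠ Literature.Computability.AlgebraicComplexity.perPoly (Fin n) ℂ :=
  hC (permNonvanishing_of hP hQ)

/-- The border target is never `0` (reduce `per_n + ε G` mod `ε`). -/
theorem borderTarget_ne_zero (n q : ℕ) (G : MvPolynomial (Fin n × Fin n) ℂ[X]) :
    borderTarget n q G ≠ 0 := by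
  intro h
  have hX : (C (Polynomial.X ^ q) : MvPolynomial (Fin n × Fin n) ℂ[X]) ≠ 0 :=
    (C_ne_zero).2 (pow_ne_zero _ Polynomial.X_ne_zero)
  have h1 : C (Polynomial.X ^ q) *
      (MvPolynomial.map Polynomial.C (perPoly (Fin n) ℂ) + C Polynomial.X * G) = 0 := by
    rw [← h, borderTarget, pow_succ, map_mul]; ring
  have h2 := (mul_eq_zero.1 h1).resolve_left hX
  have h3 := congrArg (MvPolynomial.map (Polynomial.evalRingHom (0 : ℂ))) h2
  rw [map_add, map_mul, map_C, map_map, map_zero] at h3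
  have hid : (Polynomial.evalRingHom (0 : ℂ)).comp Polynomial.C = RingHom.id ℂ := by
    ext x; simp
  rw [hid, map_id] at h3
  simp only [Polynomial.coe_evalRingHom, Polynomial.eval_X, map_zero, zero_mul, add_zero] at h3
  exact perPoly_ne_zero (Fin n) ℂ h3

/-- **Rung (border, `r ≤ 1`)**: the crux VERBATIM at top fan-in `r ≤ 1`, for every `n ≥ 2`,
every `D` and every `q` (no size bounds at all). -/
theorem chowBorderBound_fanInLeOne (hB : Sig.stub_borderFanInOne) :
    ∀ n : ℕ, 2 ≤ n → ∀ r D : ℕ, r ≤ 1 →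
    ¬ ∃ (q : ℕ) (ℓ : Fin r → Fin D → MvPolynomial (Fin n × Fin n) (Polynomial ℂ))
        (G : MvPolynomial (Fin n × Fin n) (Polynomial ℂ)),
        (∀ i j, (ℓ i j).totalDegree ≤ 1) ∧
        (∑ i, ∏ j, ℓ i j) = MvPolynomial.C (Polynomial.X ^ q) *
            MvPolynomial.map Polynomial.C
              (Literature.Computability.AlgebraicComplexity.perPoly (Fin n) ℂ) +
          MvPolynomial.C (Polynomial.X ^ (q + 1)) * G := by
  intro n hn r D hr ⟨q, ℓ, G, hdeg, hsum⟩
  rcases Nat.lt_or_ge r 1 with hr0 | hr1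
  · obtain rfl : r = 0 := by omega
    simp only [Finset.univ_eq_empty, Finset.sum_empty] at hsum
    exact borderTarget_ne_zero n q G (by rw [borderTarget]; exact hsum.symm)
  · obtain rfl : r = 1 := le_antisymm hr hr1
    rw [Fin.sum_univ_one] at hsum
    exact hB n hn D q (ℓ 0) G (fun j => hdeg 0 j) hsum


/-! ## §5 The crux at top fan-in `r = 2` (lead c2, wave 2): Kumar's theorem is tight for `per_n`

Exact divide–derive over `ℂ(x)((ε))`, fraction-free.  Ambient: `MvPolynomial (Option σ) ℂ`,
`σ = Fin n × Fin n`, with the distinguished variable `X none` playing `ε` (ε-side, stubs W2/W3) or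
the torus parameter `τ` (stubs W4/W6); `ι = Polynomial.aeval (X none)` embeds `ℂ[ε]`;
`red = aeval (Option.elim · 0 X)` is reduction `ε ↦ 0`; `quotDerivNum f g u = g^(|u|+1) ∂_u (f/g)`
(definitions file `ChowBorderDepth3ChowBorderBoundDefs.lean`, LANDED p161011).  Chain (NOTES.md ## Math memo): in the cancelling case `T₀ + T₁ = ε^(w+1) B` of a
two-summand border expression, W2 + W3 + W1 bound every ℂ-independent family of
`quotDerivNum per t₁ u` (`|u| = t`, `t₁ = red T₁`) by `4D`; W6 + W4 + W5 exhibit `C(⌊n/4⌋, s)`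
independent ones; so `C(⌊n/4⌋, ⌊n/8⌋) ≤ 4D`, i.e. `D ≥ 2^(Ω(n))`: the crux at `r = 2` for every
`D` below `2^(n/8)/(4(n/4+1))`, in particular throughout the chasm range. -/

end Summit.ValiantsHypothesis.ValiantsHypothesis.Cruxes.ChowBorderBound.Birth


/-! ### §5.0 Definitions: `ChowBorderDepth3ChowBorderBoundDefs.lean` (LANDED p161011) -/

namespace Summit.ValiantsHypothesis.ValiantsHypothesis.Cruxes.ChowBorderBound.Birth

open MvPolynomial
open Literature.Computability.AlgebraicComplexity
open scoped BigOperators Polynomial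

namespace Sig

/-- **Stub W1** — quotient-derivative calculus (true; M): (a) reduction `ε ↦ 0` commutes with `quotDerivNum` along words of `x`-variables; (b) a common factor of numerator and denominator comes out as `E^(|u|+1)`; (c) a denominator factor constant along the word comes out as `c^|u|`. -/
def stub_quotDerivCalc : Prop :=
  (∀ (n : ℕ) (f g : MvPolynomial (Option (Fin n × Fin n)) ℂ) (u : List (Fin n × Fin n)),
      MvPolynomial.aeval (fun o : Option (Fin n × Fin n) => o.elim (0 : MvPolynomial (Fin n × Fin n) ℂ) MvPolynomial.X)
          (Summit.ValiantsHypothesis.ValiantsHypothesis.Theorems.ChowBorderBound.QuotDeriv.quotDerivNum f g (u.map some)) =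
        Summit.ValiantsHypothesis.ValiantsHypothesis.Theorems.ChowBorderBound.QuotDeriv.quotDerivNum
          (MvPolynomial.aeval (fun o : Option (Fin n × Fin n) => o.elim (0 : MvPolynomial (Fin n × Fin n) ℂ) MvPolynomial.X) f)
          (MvPolynomial.aeval (fun o : Option (Fin n × Fin n) => o.elim (0 : MvPolynomial (Fin n × Fin n) ℂ) MvPolynomial.X) g) u) ∧
    (∀ (ι : Type) (f g E : MvPolynomial ι ℂ) (u : List ι),
      Summit.ValiantsHypothesis.ValiantsHypothesis.Theorems.ChowBorderBound.QuotDeriv.quotDerivNum (f * E) (g * E) u =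
        E ^ (u.length + 1) * Summit.ValiantsHypothesis.ValiantsHypothesis.Theorems.ChowBorderBound.QuotDeriv.quotDerivNum f g u) ∧
    (∀ (ι : Type) (c f g : MvPolynomial ι ℂ) (u : List ι), (∀ v ∈ u, MvPolynomial.pderiv v c = 0) →
      Summit.ValiantsHypothesis.ValiantsHypothesis.Theorems.ChowBorderBound.QuotDeriv.quotDerivNum f (c * g) u =
        c ^ u.length * Summit.ValiantsHypothesis.ValiantsHypothesis.Theorems.ChowBorderBound.QuotDeriv.quotDerivNum f g u)

/-- **Stub W2** — the ε-side of exact DiDIL at top fan-in 2 (true; M/L): if two products of ε-affine forms cancel to order `ε^(w+1)`, then `ε^w · quotDerivNum P₁ Λ u` (where `P₁/Λ = ε^(-w) ∂_ε log(T₀/T₁)` up to the displayed normalisation) lies, for every word `u` of length `t`, in the `ℂ[ε]`-span of the `4D` polynomials `∂_ε(λ_ij) Λ_îĵ^(t+1)`, `λ_ij Λ_îĵ^(t+1)` (each `∂_ελ/λ` is a function of two affine forms). -/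
def stub_epsSpan : Prop :=
  ∀ (n D w : ℕ) (lam : Fin 2 → Fin D → MvPolynomial (Option (Fin n × Fin n)) ℂ)
      (B : MvPolynomial (Option (Fin n × Fin n)) ℂ),
      (∀ i j, ∃ (a₀ : Polynomial ℂ) (a : Fin n × Fin n → Polynomial ℂ),
        lam i j = Polynomial.aeval (MvPolynomial.X (none : Option (Fin n × Fin n)) : MvPolynomial (Option (Fin n × Fin n)) ℂ) (a₀) +
          ∑ v : Fin n × Fin n, Polynomial.aeval (MvPolynomial.X (none : Option (Fin n × Fin n)) : MvPolynomial (Option (Fin n × Fin n)) ℂ) (a v) * MvPolynomial.X (some v)) →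
      (∏ j, lam 0 j) + (∏ j, lam 1 j) = (MvPolynomial.X (none : Option (Fin n × Fin n)) : MvPolynomial (Option (Fin n × Fin n)) ℂ) ^ (w + 1) * B →
      ∀ (t : ℕ) (u : Fin t → Fin n × Fin n), ∃ (c d : Fin 2 → Fin D → Polynomial ℂ),
        (MvPolynomial.X (none : Option (Fin n × Fin n)) : MvPolynomial (Option (Fin n × Fin n)) ℂ) ^ w *
            Summit.ValiantsHypothesis.ValiantsHypothesis.Theorems.ChowBorderBound.QuotDeriv.quotDerivNum
              ((w + 1) • (B * ∏ j, lam 1 j) +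
            (MvPolynomial.X (none : Option (Fin n × Fin n)) : MvPolynomial (Option (Fin n × Fin n)) ℂ) *
              (MvPolynomial.pderiv none B * ∏ j, lam 1 j - B * MvPolynomial.pderiv none (∏ j, lam 1 j)))
              ((∏ j, lam 0 j) * ∏ j, lam 1 j) (List.ofFn fun k => some (u k)) =
          ∑ i : Fin 2, ∑ j : Fin D,
            (Polynomial.aeval (MvPolynomial.X (none : Option (Fin n × Fin n)) : MvPolynomial (Option (Fin n × Fin n)) ℂ) (c i j) * MvPolynomial.pderiv none (lam i j) +
                Polynomial.aeval (MvPolynomial.X (none : Option (Fin n × Fin n)) : MvPolynomial (Option (Fin n × Fin n)) ℂ) (d i j) * lam i j) *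
              (∏ p ∈ Finset.univ.erase (i, j), lam p.1 p.2) ^ (t + 1)

/-- **Stub W3** — residue transfer of linear dependence (true; S/M): if more than `card K₁` polynomials `Y_i` satisfy `ε^e Y_i ∈ Σ_l ℂ[ε]·G_l`, their reductions mod `ε` are `ℂ`-linearly dependent (a kernel vector over `ℂ(ε)`, cleared of denominators and of its ε-content, reduces to a non-trivial relation). -/
def stub_residueTransfer : Prop :=
  ∀ (n e : ℕ) (K₁ K₂ : Type) [Fintype K₁] [Fintype K₂] (G : K₁ → MvPolynomial (Option (Fin n × Fin n)) ℂ)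
      (Y : K₂ → MvPolynomial (Option (Fin n × Fin n)) ℂ), Fintype.card K₁ < Fintype.card K₂ →
      (∀ i : K₂, ∃ c : K₁ → Polynomial ℂ,
        (MvPolynomial.X (none : Option (Fin n × Fin n)) : MvPolynomial (Option (Fin n × Fin n)) ℂ) ^ e * Y i = ∑ l, Polynomial.aeval (MvPolynomial.X (none : Option (Fin n × Fin n)) : MvPolynomial (Option (Fin n × Fin n)) ℂ) (c l) * G l) →
      ¬ LinearIndependent ℂ (fun i : K₂ =>
          MvPolynomial.aeval (fun o : Option (Fin n × Fin n) => o.elim (0 : MvPolynomial (Fin n × Fin n) ℂ) MvPolynomial.X) (Y i))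

/-- **Stub W4** — initial-form transfer (true; M/L), stated as an implication from stub W1 (spelled out): along the torus `x_v ↦ τ^(wt v) x_v`, if `f` is semi-invariant and `g` degenerates to `g₀` (`θ g = τ^M (g₀ + τ Q)`), then every `ℂ`-independent family of quotient-derivative numerators of `f/g₀` lifts to an independent family for `f/g` (chain rule `τ^⟨wt,u⟩ θ(qdn f g u) = qdn (θ f) (θ g) u`, then the lowest τ-order of a relation). -/
def stub_initialFormTransfer : Prop :=
  ((∀ (n : ℕ) (f g : MvPolynomial (Option (Fin n × Fin n)) ℂ) (u : List (Fin n × Fin n)),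
      MvPolynomial.aeval (fun o : Option (Fin n × Fin n) => o.elim (0 : MvPolynomial (Fin n × Fin n) ℂ) MvPolynomial.X)
          (Summit.ValiantsHypothesis.ValiantsHypothesis.Theorems.ChowBorderBound.QuotDeriv.quotDerivNum f g (u.map some)) =
        Summit.ValiantsHypothesis.ValiantsHypothesis.Theorems.ChowBorderBound.QuotDeriv.quotDerivNum
          (MvPolynomial.aeval (fun o : Option (Fin n × Fin n) => o.elim (0 : MvPolynomial (Fin n × Fin n) ℂ) MvPolynomial.X) f)
          (MvPolynomial.aeval (fun o : Option (Fin n × Fin n) => o.elim (0 : MvPolynomial (Fin n × Fin n) ℂ) MvPolynomial.X) g) u) ∧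
    (∀ (ι : Type) (f g E : MvPolynomial ι ℂ) (u : List ι),
      Summit.ValiantsHypothesis.ValiantsHypothesis.Theorems.ChowBorderBound.QuotDeriv.quotDerivNum (f * E) (g * E) u =
        E ^ (u.length + 1) * Summit.ValiantsHypothesis.ValiantsHypothesis.Theorems.ChowBorderBound.QuotDeriv.quotDerivNum f g u) ∧
    (∀ (ι : Type) (c f g : MvPolynomial ι ℂ) (u : List ι), (∀ v ∈ u, MvPolynomial.pderiv v c = 0) →
      Summit.ValiantsHypothesis.ValiantsHypothesis.Theorems.ChowBorderBound.QuotDeriv.quotDerivNum f (c * g) u =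
        c ^ u.length * Summit.ValiantsHypothesis.ValiantsHypothesis.Theorems.ChowBorderBound.QuotDeriv.quotDerivNum f g u)) →
    ∀ (n : ℕ) (wt : Fin n × Fin n → ℕ) (f g g₀ : MvPolynomial (Fin n × Fin n) ℂ) (W M : ℕ)
      (Q : MvPolynomial (Option (Fin n × Fin n)) ℂ),
      MvPolynomial.aeval (fun v : Fin n × Fin n => (MvPolynomial.X (none : Option (Fin n × Fin n)) : MvPolynomial (Option (Fin n × Fin n)) ℂ) ^ wt v * MvPolynomial.X (some v)) f =
        (MvPolynomial.X (none : Option (Fin n × Fin n)) : MvPolynomial (Option (Fin n × Fin n)) ℂ) ^ W * MvPolynomial.rename some f →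
      MvPolynomial.aeval (fun v : Fin n × Fin n => (MvPolynomial.X (none : Option (Fin n × Fin n)) : MvPolynomial (Option (Fin n × Fin n)) ℂ) ^ wt v * MvPolynomial.X (some v)) g =
        (MvPolynomial.X (none : Option (Fin n × Fin n)) : MvPolynomial (Option (Fin n × Fin n)) ℂ) ^ M * (MvPolynomial.rename some g₀ + (MvPolynomial.X (none : Option (Fin n × Fin n)) : MvPolynomial (Option (Fin n × Fin n)) ℂ) * Q) →
      ∀ (t : ℕ) (Γ : Finset (Fin t → Fin n × Fin n)),
        LinearIndependent ℂ (fun u : Γ =>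
          Summit.ValiantsHypothesis.ValiantsHypothesis.Theorems.ChowBorderBound.QuotDeriv.quotDerivNum f g₀ (List.ofFn fun k => u.1 k)) →
        LinearIndependent ℂ (fun u : Γ =>
          Summit.ValiantsHypothesis.ValiantsHypothesis.Theorems.ChowBorderBound.QuotDeriv.quotDerivNum f g (List.ofFn fun k => u.1 k))

/-- **Stub W6** — degeneration datum for the permanent weights `wt (i, j) = n i + j + 1` (true; M): `per_n` is semi-invariant of weight `Σ_i (n i + i + 1)`, and a non-zero product of affine forms degenerates to a non-zero scalar multiple of a monomial (`in(λ)` is the constant term if non-zero, else the unique lowest-weight variable — the weights are injective and positive). -/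
def stub_degenerationDatum : Prop :=
  (∀ n : ℕ, MvPolynomial.aeval (fun v : Fin n × Fin n => (MvPolynomial.X (none : Option (Fin n × Fin n)) : MvPolynomial (Option (Fin n × Fin n)) ℂ) ^ (n * (v.1 : ℕ) + (v.2 : ℕ) + 1) * MvPolynomial.X (some v)) (Literature.Computability.AlgebraicComplexity.perPoly (Fin n) ℂ) =
        (MvPolynomial.X (none : Option (Fin n × Fin n)) : MvPolynomial (Option (Fin n × Fin n)) ℂ) ^ (∑ i : Fin n, (n * (i : ℕ) + ((i : ℕ) + 1))) *
          MvPolynomial.rename some (Literature.Computability.AlgebraicComplexity.perPoly (Fin n) ℂ)) ∧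
    (∀ (n D : ℕ) (lam : Fin D → MvPolynomial (Fin n × Fin n) ℂ), (∀ j, (lam j).totalDegree ≤ 1) →
      (∀ j, lam j ≠ 0) → ∃ (M : ℕ) (β : (Fin n × Fin n) →₀ ℕ) (κ : ℂ) (Q : MvPolynomial (Option (Fin n × Fin n)) ℂ), κ ≠ 0 ∧
        MvPolynomial.aeval (fun v : Fin n × Fin n => (MvPolynomial.X (none : Option (Fin n × Fin n)) : MvPolynomial (Option (Fin n × Fin n)) ℂ) ^ (n * (v.1 : ℕ) + (v.2 : ℕ) + 1) * MvPolynomial.X (some v)) (∏ j, lam j) =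
          (MvPolynomial.X (none : Option (Fin n × Fin n)) : MvPolynomial (Option (Fin n × Fin n)) ℂ) ^ M *
            (MvPolynomial.rename some (MvPolynomial.C κ * MvPolynomial.monomial β 1) + (MvPolynomial.X (none : Option (Fin n × Fin n)) : MvPolynomial (Option (Fin n × Fin n)) ℂ) * Q))

/-- **Stub W5** — lower bound at monomial denominators (true; L; the lead's): for `1 ≤ s ≤ n/4` there are at least `C(⌊n/4⌋, s)` `ℂ`-independent quotient-derivative numerators `qdn per (κ x^β) u`, `|u| = s` (words inside `supp β`: witness monomials; else `≥ n/4` rows with `≥ n/4` cells off `supp β` and complementary permanental minors). -/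
def stub_monomialLowerBound : Prop :=
  ∀ (n : ℕ) (β : (Fin n × Fin n) →₀ ℕ) (κ : ℂ), κ ≠ 0 → ∀ s : ℕ, 1 ≤ s → 4 * s ≤ n →
      ∃ Γ : Finset (Fin s → Fin n × Fin n), (n / 4).choose s ≤ Γ.card ∧
        LinearIndependent ℂ (fun u : Γ =>
          Summit.ValiantsHypothesis.ValiantsHypothesis.Theorems.ChowBorderBound.QuotDeriv.quotDerivNum (Literature.Computability.AlgebraicComplexity.perPoly (Fin n) ℂ)
            (MvPolynomial.C κ * MvPolynomial.monomial β 1) (List.ofFn fun k => u.1 k))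

end Sig

/-! ### §5.1 The registered stubs of wave 2 — ALL LANDED (p161831 W1, p162397 W2, p161812 W3, p162042 W4, p161983 W6, p163679+p162861 W5) -/

/-- **Stub W1** — quotient-derivative calculus (true; M) (registered). -/
theorem stub_quotDerivCalc :
    (∀ (n : ℕ) (f g : MvPolynomial (Option (Fin n × Fin n)) ℂ) (u : List (Fin n × Fin n)),
      MvPolynomial.aeval (fun o : Option (Fin n × Fin n) => o.elim (0 : MvPolynomial (Fin n × Fin n) ℂ) MvPolynomial.X)
          (Summit.ValiantsHypothesis.ValiantsHypothesis.Theorems.ChowBorderBound.QuotDeriv.quotDerivNum f g (u.map some)) =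
        Summit.ValiantsHypothesis.ValiantsHypothesis.Theorems.ChowBorderBound.QuotDeriv.quotDerivNum
          (MvPolynomial.aeval (fun o : Option (Fin n × Fin n) => o.elim (0 : MvPolynomial (Fin n × Fin n) ℂ) MvPolynomial.X) f)
          (MvPolynomial.aeval (fun o : Option (Fin n × Fin n) => o.elim (0 : MvPolynomial (Fin n × Fin n) ℂ) MvPolynomial.X) g) u) ∧
    (∀ (ι : Type) (f g E : MvPolynomial ι ℂ) (u : List ι),
      Summit.ValiantsHypothesis.ValiantsHypothesis.Theorems.ChowBorderBound.QuotDeriv.quotDerivNum (f * E) (g * E) u =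
        E ^ (u.length + 1) * Summit.ValiantsHypothesis.ValiantsHypothesis.Theorems.ChowBorderBound.QuotDeriv.quotDerivNum f g u) ∧
    (∀ (ι : Type) (c f g : MvPolynomial ι ℂ) (u : List ι), (∀ v ∈ u, MvPolynomial.pderiv v c = 0) →
      Summit.ValiantsHypothesis.ValiantsHypothesis.Theorems.ChowBorderBound.QuotDeriv.quotDerivNum f (c * g) u =
        c ^ u.length * Summit.ValiantsHypothesis.ValiantsHypothesis.Theorems.ChowBorderBound.QuotDeriv.quotDerivNum f g u) :=
  Summit.ValiantsHypothesis.ValiantsHypothesis.Theorems.ChowBorderBound.QuotDerivCalc.stub_quotDerivCalc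

/-- **Stub W2** — the ε-side of exact DiDIL at top fan-in 2 (true; M/L) (registered). -/
theorem stub_epsSpan :
    ∀ (n D w : ℕ) (lam : Fin 2 → Fin D → MvPolynomial (Option (Fin n × Fin n)) ℂ)
      (B : MvPolynomial (Option (Fin n × Fin n)) ℂ),
      (∀ i j, ∃ (a₀ : Polynomial ℂ) (a : Fin n × Fin n → Polynomial ℂ),
        lam i j = Polynomial.aeval (MvPolynomial.X (none : Option (Fin n × Fin n)) : MvPolynomial (Option (Fin n × Fin n)) ℂ) (a₀) +
          ∑ v : Fin n × Fin n, Polynomial.aeval (MvPolynomial.X (none : Option (Fin n × Fin n)) : MvPolynomial (Option (Fin n × Fin n)) ℂ) (a v) * MvPolynomial.X (some v)) →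
      (∏ j, lam 0 j) + (∏ j, lam 1 j) = (MvPolynomial.X (none : Option (Fin n × Fin n)) : MvPolynomial (Option (Fin n × Fin n)) ℂ) ^ (w + 1) * B →
      ∀ (t : ℕ) (u : Fin t → Fin n × Fin n), ∃ (c d : Fin 2 → Fin D → Polynomial ℂ),
        (MvPolynomial.X (none : Option (Fin n × Fin n)) : MvPolynomial (Option (Fin n × Fin n)) ℂ) ^ w *
            Summit.ValiantsHypothesis.ValiantsHypothesis.Theorems.ChowBorderBound.QuotDeriv.quotDerivNum
              ((w + 1) • (B * ∏ j, lam 1 j) +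
            (MvPolynomial.X (none : Option (Fin n × Fin n)) : MvPolynomial (Option (Fin n × Fin n)) ℂ) *
              (MvPolynomial.pderiv none B * ∏ j, lam 1 j - B * MvPolynomial.pderiv none (∏ j, lam 1 j)))
              ((∏ j, lam 0 j) * ∏ j, lam 1 j) (List.ofFn fun k => some (u k)) =
          ∑ i : Fin 2, ∑ j : Fin D,
            (Polynomial.aeval (MvPolynomial.X (none : Option (Fin n × Fin n)) : MvPolynomial (Option (Fin n × Fin n)) ℂ) (c i j) * MvPolynomial.pderiv none (lam i j) +
                Polynomial.aeval (MvPolynomial.X (none : Option (Fin n × Fin n)) : MvPolynomial (Option (Fin n × Fin n)) ℂ) (d i j) * lam i j) *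
              (∏ p ∈ Finset.univ.erase (i, j), lam p.1 p.2) ^ (t + 1) :=
  Summit.ValiantsHypothesis.ValiantsHypothesis.Theorems.ChowBorderBound.EpsSpan.stub_epsSpan

/-- **Stub W3** — residue transfer of linear dependence (true; S/M) (registered). -/
theorem stub_residueTransfer :
    ∀ (n e : ℕ) (K₁ K₂ : Type) [Fintype K₁] [Fintype K₂] (G : K₁ → MvPolynomial (Option (Fin n × Fin n)) ℂ)
      (Y : K₂ → MvPolynomial (Option (Fin n × Fin n)) ℂ), Fintype.card K₁ < Fintype.card K₂ →
      (∀ i : K₂, ∃ c : K₁ → Polynomial ℂ,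
        (MvPolynomial.X (none : Option (Fin n × Fin n)) : MvPolynomial (Option (Fin n × Fin n)) ℂ) ^ e * Y i = ∑ l, Polynomial.aeval (MvPolynomial.X (none : Option (Fin n × Fin n)) : MvPolynomial (Option (Fin n × Fin n)) ℂ) (c l) * G l) →
      ¬ LinearIndependent ℂ (fun i : K₂ =>
          MvPolynomial.aeval (fun o : Option (Fin n × Fin n) => o.elim (0 : MvPolynomial (Fin n × Fin n) ℂ) MvPolynomial.X) (Y i)) :=
  Summit.ValiantsHypothesis.ValiantsHypothesis.Theorems.ChowBorderBound.ResidueTransfer.stub_residueTransfer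

/-- **Stub W4** — initial-form transfer (true; M/L) (registered). -/
theorem stub_initialFormTransfer :
    ((∀ (n : ℕ) (f g : MvPolynomial (Option (Fin n × Fin n)) ℂ) (u : List (Fin n × Fin n)),
      MvPolynomial.aeval (fun o : Option (Fin n × Fin n) => o.elim (0 : MvPolynomial (Fin n × Fin n) ℂ) MvPolynomial.X)
          (Summit.ValiantsHypothesis.ValiantsHypothesis.Theorems.ChowBorderBound.QuotDeriv.quotDerivNum f g (u.map some)) =
        Summit.ValiantsHypothesis.ValiantsHypothesis.Theorems.ChowBorderBound.QuotDeriv.quotDerivNum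
          (MvPolynomial.aeval (fun o : Option (Fin n × Fin n) => o.elim (0 : MvPolynomial (Fin n × Fin n) ℂ) MvPolynomial.X) f)
          (MvPolynomial.aeval (fun o : Option (Fin n × Fin n) => o.elim (0 : MvPolynomial (Fin n × Fin n) ℂ) MvPolynomial.X) g) u) ∧
    (∀ (ι : Type) (f g E : MvPolynomial ι ℂ) (u : List ι),
      Summit.ValiantsHypothesis.ValiantsHypothesis.Theorems.ChowBorderBound.QuotDeriv.quotDerivNum (f * E) (g * E) u =
        E ^ (u.length + 1) * Summit.ValiantsHypothesis.ValiantsHypothesis.Theorems.ChowBorderBound.QuotDeriv.quotDerivNum f g u) ∧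
    (∀ (ι : Type) (c f g : MvPolynomial ι ℂ) (u : List ι), (∀ v ∈ u, MvPolynomial.pderiv v c = 0) →
      Summit.ValiantsHypothesis.ValiantsHypothesis.Theorems.ChowBorderBound.QuotDeriv.quotDerivNum f (c * g) u =
        c ^ u.length * Summit.ValiantsHypothesis.ValiantsHypothesis.Theorems.ChowBorderBound.QuotDeriv.quotDerivNum f g u)) →
    ∀ (n : ℕ) (wt : Fin n × Fin n → ℕ) (f g g₀ : MvPolynomial (Fin n × Fin n) ℂ) (W M : ℕ)
      (Q : MvPolynomial (Option (Fin n × Fin n)) ℂ),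
      MvPolynomial.aeval (fun v : Fin n × Fin n => (MvPolynomial.X (none : Option (Fin n × Fin n)) : MvPolynomial (Option (Fin n × Fin n)) ℂ) ^ wt v * MvPolynomial.X (some v)) f =
        (MvPolynomial.X (none : Option (Fin n × Fin n)) : MvPolynomial (Option (Fin n × Fin n)) ℂ) ^ W * MvPolynomial.rename some f →
      MvPolynomial.aeval (fun v : Fin n × Fin n => (MvPolynomial.X (none : Option (Fin n × Fin n)) : MvPolynomial (Option (Fin n × Fin n)) ℂ) ^ wt v * MvPolynomial.X (some v)) g =
        (MvPolynomial.X (none : Option (Fin n × Fin n)) : MvPolynomial (Option (Fin n × Fin n)) ℂ) ^ M * (MvPolynomial.rename some g₀ + (MvPolynomial.X (none : Option (Fin n × Fin n)) : MvPolynomial (Option (Fin n × Fin n)) ℂ) * Q) →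
      ∀ (t : ℕ) (Γ : Finset (Fin t → Fin n × Fin n)),
        LinearIndependent ℂ (fun u : Γ =>
          Summit.ValiantsHypothesis.ValiantsHypothesis.Theorems.ChowBorderBound.QuotDeriv.quotDerivNum f g₀ (List.ofFn fun k => u.1 k)) →
        LinearIndependent ℂ (fun u : Γ =>
          Summit.ValiantsHypothesis.ValiantsHypothesis.Theorems.ChowBorderBound.QuotDeriv.quotDerivNum f g (List.ofFn fun k => u.1 k)) :=
  Summit.ValiantsHypothesis.ValiantsHypothesis.Theorems.ChowBorderBound.InitialFormTransfer.stub_initialFormTransfer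

/-- **Stub W6** — degeneration datum for the permanent weights `wt (i, j) = n i + j + 1` (true; M) (registered). -/
theorem stub_degenerationDatum :
    (∀ n : ℕ, MvPolynomial.aeval (fun v : Fin n × Fin n => (MvPolynomial.X (none : Option (Fin n × Fin n)) : MvPolynomial (Option (Fin n × Fin n)) ℂ) ^ (n * (v.1 : ℕ) + (v.2 : ℕ) + 1) * MvPolynomial.X (some v)) (Literature.Computability.AlgebraicComplexity.perPoly (Fin n) ℂ) =
        (MvPolynomial.X (none : Option (Fin n × Fin n)) : MvPolynomial (Option (Fin n × Fin n)) ℂ) ^ (∑ i : Fin n, (n * (i : ℕ) + ((i : ℕ) + 1))) *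
          MvPolynomial.rename some (Literature.Computability.AlgebraicComplexity.perPoly (Fin n) ℂ)) ∧
    (∀ (n D : ℕ) (lam : Fin D → MvPolynomial (Fin n × Fin n) ℂ), (∀ j, (lam j).totalDegree ≤ 1) →
      (∀ j, lam j ≠ 0) → ∃ (M : ℕ) (β : (Fin n × Fin n) →₀ ℕ) (κ : ℂ) (Q : MvPolynomial (Option (Fin n × Fin n)) ℂ), κ ≠ 0 ∧
        MvPolynomial.aeval (fun v : Fin n × Fin n => (MvPolynomial.X (none : Option (Fin n × Fin n)) : MvPolynomial (Option (Fin n × Fin n)) ℂ) ^ (n * (v.1 : ℕ) + (v.2 : ℕ) + 1) * MvPolynomial.X (some v)) (∏ j, lam j) =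
          (MvPolynomial.X (none : Option (Fin n × Fin n)) : MvPolynomial (Option (Fin n × Fin n)) ℂ) ^ M *
            (MvPolynomial.rename some (MvPolynomial.C κ * MvPolynomial.monomial β 1) + (MvPolynomial.X (none : Option (Fin n × Fin n)) : MvPolynomial (Option (Fin n × Fin n)) ℂ) * Q)) :=
  Summit.ValiantsHypothesis.ValiantsHypothesis.Theorems.ChowBorderBound.DegenerationDatum.stub_degenerationDatum

/-- **Stub W5** — lower bound at monomial denominators (true; L; the lead's) (registered). -/
theorem stub_monomialLowerBound :
    ∀ (n : ℕ) (β : (Fin n × Fin n) →₀ ℕ) (κ : ℂ), κ ≠ 0 → ∀ s : ℕ, 1 ≤ s → 4 * s ≤ n →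
      ∃ Γ : Finset (Fin s → Fin n × Fin n), (n / 4).choose s ≤ Γ.card ∧
        LinearIndependent ℂ (fun u : Γ =>
          Summit.ValiantsHypothesis.ValiantsHypothesis.Theorems.ChowBorderBound.QuotDeriv.quotDerivNum (Literature.Computability.AlgebraicComplexity.perPoly (Fin n) ℂ)
            (MvPolynomial.C κ * MvPolynomial.monomial β 1) (List.ofFn fun k => u.1 k)) :=
  Summit.ValiantsHypothesis.ValiantsHypothesis.Theorems.ChowBorderBound.MonomialLowerBound.stub_monomialLowerBound


/-! ### §5.2 Glue (sorry-free): the `r ≤ 2` rung of the crux, assembled and LANDED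

Assembly files (lead c2): `ChowBorderDepth3ChowBorderBoundFanInTwoBounds.lean` (p165019: upper
bound `card_le_of_cancelling`, lower bound `exists_independent_of_affine_prod`),
`…FanInTwoChasmArith.lean` (p165440: `4 (n+2)^(c√n+c) < C(⌊n/4⌋,⌊n/8⌋)` eventually),
`…FanInTwo.lean` (p165877: `choose_le_of_fanInTwo : C(⌊n/4⌋, ⌊n/8⌋) ≤ 4D`, and the rung below). -/

/-- **Rung `r ≤ 2` (LANDED p165877)**: the crux VERBATIM with its top-fan-in bound
`r ≤ (n+2)^(c⌊√n⌋+c)` replaced by `r ≤ 2` — for every `c`, all large `n`, all `r ≤ 2` and all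
`D ≤ (n+2)^(c⌊√n⌋+c)`, the padded permanent has no border expression
`Σ_{i<r} Π_{j<D} ℓ_ij = ε^q per_n + ε^(q+1) G`.  Map of the crux after c2: PROVED for `r ≤ 2`
(all chasm `D`), for exact expressions (`q = 0`) with `r < n` (all `D`), and for
`D ≤ n^(3/2−δ)` (all chasm `r`, c1); OPEN for `3 ≤ r ≤ chasm` with `n^(3/2) ≲ D ≤ chasm`. -/
theorem chowBorderBound_fanInLeTwo :
    ∀ c : ℕ, ∃ n₀ : ℕ, ∀ n ≥ n₀, ∀ r D : ℕ, r ≤ 2 → D ≤ (n + 2) ^ (c * Nat.sqrt n + c) →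
    ¬ ∃ (q : ℕ) (ℓ : Fin r → Fin D → MvPolynomial (Fin n × Fin n) (Polynomial ℂ))
        (G : MvPolynomial (Fin n × Fin n) (Polynomial ℂ)),
        (∀ i j, (ℓ i j).totalDegree ≤ 1) ∧
        (∑ i, ∏ j, ℓ i j) = MvPolynomial.C (Polynomial.X ^ q) *
            MvPolynomial.map Polynomial.C
              (Literature.Computability.AlgebraicComplexity.perPoly (Fin n) ℂ) +
          MvPolynomial.C (Polynomial.X ^ (q + 1)) * G :=
  Summit.ValiantsHypothesis.ValiantsHypothesis.Theorems.ChowBorderBound.FanInTwo.chowBorderBound_fanInLeTwo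

end Summit.ValiantsHypothesis.ValiantsHypothesis.Cruxes.ChowBorderBound.Birth

end
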